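import Literature.Computability.Cryptography.LWENoise
import Literature.Computability.Cryptography.StatisticalDistance
import Mathlib.Probability.Moments.Variance
import Mathlib.MeasureTheory.Function.L2Space
import HarnessLib

/-!
# A small change of the width does not change `Ψ_α` by much (Regev 2009, Claim 2.2)

Topic `Computability/Cryptography` (LWE noise), grouping namespace `LWE`; sibling of `LWENoise.lean`
(`wrappedGaussian α = Ψ_α`, `discretizedGaussian q α = Ψ̄_α`, both images of the real Gaussian
`gaussianReal 0 (α²/(2π))` of density `α⁻¹ exp(-π(x/α)²)`). Proved material (no named fact) towards
the named facts `regev_lwe_to_sivp_quantum` / `peikert_gapSVPZeta_to_lwe_classical` /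
`blprs_gapSVP_sqrt_dim_to_lwe_classical` (pqc.S19–S21), all of which normalise an LWE oracle for an
UNKNOWN noise rate `β ≤ α` to the rate `α` by adding noise in small increments (Regev 2009,
Lemma 3.7; Peikert 2009, §3 "Regev's Lemmas 3.5–3.7"; BLPRS 2013, Lemma 2.15 — "The proof is standard
(see, e.g., [Regev 2009])"), the analytic input being:

> **Claim 2.2** (Regev 2009). For any `0 < α < β ≤ 2α`, `Δ(Ψ_α, Ψ_β) ≤ 9 (β/α - 1)`.
>
> *Proof.* We will show that the statistical distance between a normal variable with standard
> deviation `α/√(2π)` and one with standard deviation `β/√(2π)` is at most `9(β/α - 1)`. This implies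
> the claim since applying a function (modulo `1` in this case) cannot increase the statistical
> distance. [… `∫ |e^{-πx²} - (1+ε)⁻¹ e^{-πx²/(1+ε)²}| dx ≤ ε + 2πε ∫ x² e^{-πx²/(1+ε)²} dx = ε + ε(1+ε)³ ≤ 9ε`.]

## Results (widths `0 < a ≤ b`, densities `p_a(x) = a⁻¹ e^{-πx²/a²}`)

* `gaussianPDFReal_width` — Mathlib's `gaussianPDFReal 0 (a²/(2π)) x = a⁻¹ exp(-πx²/a²)`;
  `integral_exp_neg_pi_sq_div` (`∫ e^{-πx²/b²} = b`), `integral_sq_mul_exp_neg_pi_sq_div`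
  (`∫ x² e^{-πx²/b²} = b³/(2π)`, from the variance of `gaussianReal`);
* `abs_gaussianPDFReal_width_sub_le` — the printed pointwise bound
  `|p_a - p_b| ≤ a⁻¹ π(a⁻² - b⁻²) x² e^{-πx²/b²} + (a⁻¹ - b⁻¹) e^{-πx²/b²}` (`1 - e^{-z} ≤ z`);
* `integral_abs_gaussianPDFReal_width_sub_le` — **`∫ |p_a - p_b| ≤ 4 (b/a - 1)`** for `b ≤ 2a`
  (the printed computation, with the sharper `π(a⁻² - b⁻²)` kept in place of Regev's `2πε`; Regev's
  constant is `9`);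
* **`abs_measureReal_gaussianReal_width_sub_le`** (real Gaussians, every measurable event),
  **`abs_measureReal_wrappedGaussian_sub_le`** (`Ψ_a` versus `Ψ_b` on the torus: "applying a function
  cannot increase the statistical distance"), and **`tvDist_discretizedGaussian_le`**
  (`Δ(Ψ̄_a, Ψ̄_b) ≤ 2 (b/a - 1)` for the tree's `PMF.tvDist`, summing over the fibres of `⌊q x⌉ mod q`);
  all `≤ 9 (b/a - 1)` as printed (`…_le_nine`).

## References

* O. Regev, *On lattices, learning with errors, random linear codes, and cryptography*, J. ACM 56
  (2009), art. 34, §2, Claim 2.2 and its proof; Lemma 3.7 (use) (held: arXiv:2401.03703, pp. 12, 17).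
* Z. Brakerski, A. Langlois, C. Peikert, O. Regev, D. Stehlé, *Classical hardness of learning with
  errors*, STOC 2013, Lemma 2.15 (use).
-/

noncomputable section

open MeasureTheory ProbabilityTheory Real
open scoped ENNReal NNReal

namespace Literature.Computability.Cryptography

namespace LWE

/-! ### The density of width `a` and two Gaussian integrals -/

/-- The variance parameter of the real Gaussian of width `a`: `a²/(2π)`. [cite: Regev2009, §2] -/
def widthVar (a : ℝ) : ℝ≥0 := Real.toNNReal (a ^ 2 / (2 * Real.pi))

/-- `widthVar a = a²/(2π)` as a real number. [folklore] -/
theorem coe_widthVar (a : ℝ) : (widthVar a : ℝ) = a ^ 2 / (2 * Real.pi) :=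
  Real.coe_toNNReal _ (by positivity)

/-- `widthVar a ≠ 0` for `a ≠ 0`. [folklore] -/
theorem widthVar_ne_zero {a : ℝ} (ha : 0 < a) : widthVar a ≠ 0 := by
  intro h
  have h' : (widthVar a : ℝ) = 0 := by rw [h]; rfl
  rw [coe_widthVar] at h'
  have : 0 < a ^ 2 / (2 * Real.pi) := by positivity
  linarith

/-- **The density of width `a`**: Mathlib's `gaussianPDFReal 0 (a²/(2π)) x = a⁻¹ exp(-πx²/a²)` (Regev
2009, §2: "the density of `X` is `α⁻¹ exp(-π(x/α)²)`"). [cite: Regev2009, §2] -/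
theorem gaussianPDFReal_width {a : ℝ} (ha : 0 < a) (x : ℝ) :
    gaussianPDFReal 0 (widthVar a) x = a⁻¹ * Real.exp (-(Real.pi * x ^ 2 / a ^ 2)) := by
  rw [gaussianPDFReal, coe_widthVar, sub_zero]
  have h1 : 2 * Real.pi * (a ^ 2 / (2 * Real.pi)) = a ^ 2 := by field_simp
  have h2 : -x ^ 2 / (2 * (a ^ 2 / (2 * Real.pi))) = -(Real.pi * x ^ 2 / a ^ 2) := by
    field_simp
  rw [h1, Real.sqrt_sq ha.le, h2]

/-- `∫ e^{-πx²/b²} dx = b` for `b > 0`. [folklore] -/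
theorem integral_exp_neg_pi_sq_div {b : ℝ} (hb : 0 < b) :
    ∫ x, Real.exp (-(Real.pi * x ^ 2 / b ^ 2)) = b := by
  have h := integral_gaussian (Real.pi / b ^ 2)
  have hfun : (fun x : ℝ => Real.exp (-(Real.pi / b ^ 2) * x ^ 2)) = fun x => Real.exp (-(Real.pi * x ^ 2 / b ^ 2)) := by
    funext x; congr 1; ring
  rw [hfun] at h
  rw [h, show Real.pi / (Real.pi / b ^ 2) = b ^ 2 by field_simp, Real.sqrt_sq hb.le]

/-- `∫ x² e^{-πx²/b²} dx = b³/(2π)` for `b > 0`: the second moment of `gaussianReal 0 (b²/(2π))` is its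
variance parameter. [folklore] -/
theorem integral_sq_mul_exp_neg_pi_sq_div {b : ℝ} (hb : 0 < b) :
    ∫ x, x ^ 2 * Real.exp (-(Real.pi * x ^ 2 / b ^ 2)) = b ^ 3 / (2 * Real.pi) := by
  have hv := widthVar_ne_zero hb
  -- second moment of the Gaussian measure
  have hvar : ∫ x, x ^ 2 ∂gaussianReal 0 (widthVar b) = (widthVar b : ℝ) := by
    have h := variance_fun_id_gaussianReal (μ := 0) (v := widthVar b)
    rw [variance_eq_integral measurable_id'.aemeasurable] at h
    simpa [integral_id_gaussianReal] using h
  rw [integral_gaussianReal_eq_integral_smul hv] at hvar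
  simp_rw [gaussianPDFReal_width hb, smul_eq_mul] at hvar
  -- `∫ b⁻¹ e(x) x² = b²/(2π)` gives `∫ x² e(x) = b · b²/(2π)`
  have h2 : ∫ x, x ^ 2 * Real.exp (-(Real.pi * x ^ 2 / b ^ 2)) =
      b * ∫ x, b⁻¹ * Real.exp (-(Real.pi * x ^ 2 / b ^ 2)) * x ^ 2 := by
    rw [← integral_const_mul]
    refine integral_congr_ae (ae_of_all _ fun x => ?_)
    field_simp
  rw [h2, hvar, coe_widthVar]
  field_simp

/-- Integrability of `x² e^{-πx²/b²}` (finite second moment of the Gaussian). [folklore] -/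
theorem integrable_sq_mul_exp_neg_pi_sq_div {b : ℝ} (hb : 0 < b) :
    Integrable fun x : ℝ => x ^ 2 * Real.exp (-(Real.pi * x ^ 2 / b ^ 2)) := by
  have hv := widthVar_ne_zero hb
  have hmem : Integrable (fun x : ℝ => x ^ 2) (gaussianReal 0 (widthVar b)) :=
    (memLp_two_iff_integrable_sq measurable_id.aestronglyMeasurable).1 (memLp_id_gaussianReal 2)
  rw [gaussianReal_of_var_ne_zero _ hv, integrable_withDensity_iff (measurable_gaussianPDF _ _)
    (ae_of_all _ fun _ => gaussianPDF_lt_top)] at hmem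
  simp_rw [toReal_gaussianPDF, gaussianPDFReal_width hb] at hmem
  have h := hmem.const_mul b
  refine h.congr (ae_of_all _ fun x => ?_)
  field_simp

/-- Integrability of `e^{-πx²/b²}`. [folklore] -/
theorem integrable_exp_neg_pi_sq_div {b : ℝ} (hb : 0 < b) :
    Integrable fun x : ℝ => Real.exp (-(Real.pi * x ^ 2 / b ^ 2)) := by
  have h := integrable_exp_neg_mul_sq (show 0 < Real.pi / b ^ 2 by positivity)
  refine h.congr (ae_of_all _ fun x => ?_)
  show Real.exp (-(Real.pi / b ^ 2) * x ^ 2) = Real.exp (-(Real.pi * x ^ 2 / b ^ 2))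
  congr 1; ring

/-! ### The pointwise bound and the `L¹` bound -/

/-- **The printed pointwise bound.** For `0 < a ≤ b` and all `x`,
`|p_a(x) - p_b(x)| ≤ a⁻¹ · π(a⁻² - b⁻²) x² · e^{-πx²/b²} + (a⁻¹ - b⁻¹) e^{-πx²/b²}`: split
`p_a - p_b = a⁻¹(e_a - e_b) + (a⁻¹ - b⁻¹) e_b` and use `0 ≤ e_b - e_a = e_b (1 - e^{-z}) ≤ e_b z`,
`z = π(a⁻² - b⁻²)x² ≥ 0` ("since `1 - z ≤ e^{-z} ≤ 1` for all `z ≥ 0`"). [cite: Regev2009, Claim 2.2 (proof)] -/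
theorem abs_gaussianPDFReal_width_sub_le {a b : ℝ} (ha : 0 < a) (hab : a ≤ b) (x : ℝ) :
    |gaussianPDFReal 0 (widthVar a) x - gaussianPDFReal 0 (widthVar b) x| ≤
      a⁻¹ * (Real.pi * (a⁻¹ ^ 2 - b⁻¹ ^ 2) * x ^ 2) * Real.exp (-(Real.pi * x ^ 2 / b ^ 2)) +
        (a⁻¹ - b⁻¹) * Real.exp (-(Real.pi * x ^ 2 / b ^ 2)) := by
  have hb : 0 < b := lt_of_lt_of_le ha hab
  rw [gaussianPDFReal_width ha, gaussianPDFReal_width hb]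
  set ea := Real.exp (-(Real.pi * x ^ 2 / a ^ 2)) with hea
  set eb := Real.exp (-(Real.pi * x ^ 2 / b ^ 2)) with heb
  set z := Real.pi * (a⁻¹ ^ 2 - b⁻¹ ^ 2) * x ^ 2 with hz
  have heb0 : 0 < eb := Real.exp_pos _
  have hinv : b⁻¹ ≤ a⁻¹ := by rw [inv_le_inv₀ hb ha]; exact hab
  have hinv2 : b⁻¹ ^ 2 ≤ a⁻¹ ^ 2 := pow_le_pow_left₀ (inv_nonneg.2 hb.le) hinv 2
  have hz0 : 0 ≤ z := by
    have : 0 ≤ a⁻¹ ^ 2 - b⁻¹ ^ 2 := by linarith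
    positivity
  -- `e_a = e_b · e^{-z}`
  have hea_eq : ea = eb * Real.exp (-z) := by
    rw [hea, heb, ← Real.exp_add]
    congr 1
    rw [hz]
    field_simp
    ring
  have hza : ea ≤ eb := by
    rw [hea_eq]
    have : Real.exp (-z) ≤ 1 := by rw [Real.exp_le_one_iff]; linarith
    nlinarith
  -- `1 - e^{-z} ≤ z`
  have h1z : eb - ea ≤ eb * z := by
    rw [hea_eq]
    have h := Real.add_one_le_exp (-z)
    nlinarith
  calc |a⁻¹ * ea - b⁻¹ * eb| = |a⁻¹ * (ea - eb) + (a⁻¹ - b⁻¹) * eb| := by ring_nf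
    _ ≤ |a⁻¹ * (ea - eb)| + |(a⁻¹ - b⁻¹) * eb| := abs_add_le _ _
    _ = a⁻¹ * (eb - ea) + (a⁻¹ - b⁻¹) * eb := by
        rw [abs_mul, abs_of_pos (inv_pos.2 ha), abs_of_nonpos (by linarith), abs_of_nonneg]
        · ring
        · exact mul_nonneg (by linarith) heb0.le
    _ ≤ a⁻¹ * (eb * z) + (a⁻¹ - b⁻¹) * eb := by
        gcongr
    _ = a⁻¹ * z * eb + (a⁻¹ - b⁻¹) * eb := by ring

/-- **`∫ |p_a - p_b| ≤ 4 (b/a - 1)` for `0 < a ≤ b ≤ 2a`** (the printed computation: the two integrals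
are `a⁻¹ π(a⁻² - b⁻²) · b³/(2π) = (b/a)(b/a - 1)(b/a + 1)/2 ≤ 3(b/a - 1)` and `(a⁻¹ - b⁻¹) b = b/a - 1`).
[cite: Regev2009, Claim 2.2 (proof)] -/
theorem integral_abs_gaussianPDFReal_width_sub_le {a b : ℝ} (ha : 0 < a) (hab : a ≤ b) (hb2 : b ≤ 2 * a) :
    ∫ x, |gaussianPDFReal 0 (widthVar a) x - gaussianPDFReal 0 (widthVar b) x| ≤ 4 * (b / a - 1) := by
  have hb : 0 < b := lt_of_lt_of_le ha hab
  have hI1 := integrable_sq_mul_exp_neg_pi_sq_div hb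
  have hI0 := integrable_exp_neg_pi_sq_div hb
  -- integrate the pointwise bound
  have hdom : Integrable fun x : ℝ => a⁻¹ * (Real.pi * (a⁻¹ ^ 2 - b⁻¹ ^ 2) * x ^ 2) *
      Real.exp (-(Real.pi * x ^ 2 / b ^ 2)) + (a⁻¹ - b⁻¹) * Real.exp (-(Real.pi * x ^ 2 / b ^ 2)) := by
    refine Integrable.add ?_ (hI0.const_mul _)
    have h := hI1.const_mul (a⁻¹ * (Real.pi * (a⁻¹ ^ 2 - b⁻¹ ^ 2)))
    refine h.congr (ae_of_all _ fun x => ?_)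
    simp only; ring
  have hle := integral_mono ((integrable_gaussianPDFReal 0 (widthVar a)).sub
    (integrable_gaussianPDFReal 0 (widthVar b))).abs hdom (fun x => abs_gaussianPDFReal_width_sub_le ha hab x)
  refine hle.trans ?_
  -- evaluate
  rw [integral_add _ (hI0.const_mul _), integral_const_mul, integral_exp_neg_pi_sq_div hb]
  swap
  · have h := hI1.const_mul (a⁻¹ * (Real.pi * (a⁻¹ ^ 2 - b⁻¹ ^ 2)))
    refine h.congr (ae_of_all _ fun x => ?_)
    simp only; ring
  have hfirst : ∫ x, a⁻¹ * (Real.pi * (a⁻¹ ^ 2 - b⁻¹ ^ 2) * x ^ 2) * Real.exp (-(Real.pi * x ^ 2 / b ^ 2)) =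
      a⁻¹ * (Real.pi * (a⁻¹ ^ 2 - b⁻¹ ^ 2)) * (b ^ 3 / (2 * Real.pi)) := by
    rw [← integral_sq_mul_exp_neg_pi_sq_div hb, ← integral_const_mul]
    refine integral_congr_ae (ae_of_all _ fun x => ?_)
    simp only; ring
  rw [hfirst]
  -- pure algebra in `t = b/a ∈ [1, 2]`
  have hπ : Real.pi ≠ 0 := Real.pi_pos.ne'
  have ha0 : a ≠ 0 := ha.ne'
  have hb0 : b ≠ 0 := hb.ne'
  set t := b / a with ht
  have ht1 : 1 ≤ t := by rw [ht, le_div_iff₀ ha]; linarith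
  have ht2 : t ≤ 2 := by rw [ht, div_le_iff₀ ha]; linarith
  have hexpr : a⁻¹ * (Real.pi * (a⁻¹ ^ 2 - b⁻¹ ^ 2)) * (b ^ 3 / (2 * Real.pi)) + (a⁻¹ - b⁻¹) * b =
      t * (t - 1) * (t + 1) / 2 + (t - 1) := by
    rw [ht]
    field_simp
    ring
  rw [hexpr]
  have hB : 0 ≤ t - 1 := by linarith
  have hA : t * (t + 1) / 2 + 1 ≤ 4 := by nlinarith
  calc t * (t - 1) * (t + 1) / 2 + (t - 1) = (t - 1) * (t * (t + 1) / 2 + 1) := by ring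
    _ ≤ (t - 1) * 4 := mul_le_mul_of_nonneg_left hA hB
    _ = 4 * (b / a - 1) := by rw [ht]; ring

/-! ### Event forms: real, wrapped and discretised Gaussians -/

/-- The measure of an event under the real Gaussian of width `a`, as the integral of the density.
[folklore] -/
theorem measureReal_gaussianReal_width {a : ℝ} (ha : 0 < a) (A : Set ℝ) :
    (gaussianReal 0 (widthVar a)).real A = ∫ x in A, gaussianPDFReal 0 (widthVar a) x := by
  rw [measureReal_def, gaussianReal_apply_eq_integral _ (widthVar_ne_zero ha),
    ENNReal.toReal_ofReal (integral_nonneg fun x => gaussianPDFReal_nonneg _ _ x)]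

/-- **Real Gaussians of widths `a ≤ b ≤ 2a`: every event changes by at most `4 (b/a - 1)`** (so the
statistical distance `sup_A |·|` is `≤ 4(b/a - 1) ≤ 9(b/a - 1)`): `|∫_A (p_a - p_b)| ≤ ∫ |p_a - p_b|`.
[cite: Regev2009, Claim 2.2] -/
theorem abs_measureReal_gaussianReal_width_sub_le {a b : ℝ} (ha : 0 < a) (hab : a ≤ b) (hb2 : b ≤ 2 * a)
    (A : Set ℝ) :
    |(gaussianReal 0 (widthVar a)).real A - (gaussianReal 0 (widthVar b)).real A| ≤ 4 * (b / a - 1) := by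
  have hb : 0 < b := lt_of_lt_of_le ha hab
  have hpa := integrable_gaussianPDFReal 0 (widthVar a)
  have hpb := integrable_gaussianPDFReal 0 (widthVar b)
  rw [measureReal_gaussianReal_width ha, measureReal_gaussianReal_width hb,
    ← integral_sub hpa.integrableOn hpb.integrableOn]
  calc |∫ x in A, gaussianPDFReal 0 (widthVar a) x - gaussianPDFReal 0 (widthVar b) x|
      ≤ ∫ x in A, |gaussianPDFReal 0 (widthVar a) x - gaussianPDFReal 0 (widthVar b) x| :=
        abs_integral_le_integral_abs
    _ ≤ ∫ x, |gaussianPDFReal 0 (widthVar a) x - gaussianPDFReal 0 (widthVar b) x| :=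
        setIntegral_le_integral (hpa.sub hpb).abs (ae_of_all _ fun x => abs_nonneg _)
    _ ≤ 4 * (b / a - 1) := integral_abs_gaussianPDFReal_width_sub_le ha hab hb2

/-- **Regev 2009, Claim 2.2 on the torus** ("applying a function (modulo `1` in this case) cannot
increase the statistical distance"): for `0 < a ≤ b ≤ 2a` and every measurable `B ⊆ 𝕋`,
`|Ψ_a(B) - Ψ_b(B)| ≤ 4 (b/a - 1) ≤ 9 (b/a - 1)`. [cite: Regev2009, Claim 2.2] -/
theorem abs_measureReal_wrappedGaussian_sub_le {a b : ℝ} (ha : 0 < a) (hab : a ≤ b) (hb2 : b ≤ 2 * a)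
    {B : Set UnitAddCircle} (hB : MeasurableSet B) :
    |(wrappedGaussian a).real B - (wrappedGaussian b).real B| ≤ 4 * (b / a - 1) := by
  simp only [wrappedGaussian, measureReal_def, Measure.map_apply measurable_coe_unitAddCircle hB]
  exact abs_measureReal_gaussianReal_width_sub_le ha hab hb2 _

/-- The printed constant: `|Ψ_a(B) - Ψ_b(B)| ≤ 9 (b/a - 1)`. [cite: Regev2009, Claim 2.2] -/
theorem abs_measureReal_wrappedGaussian_sub_le_nine {a b : ℝ} (ha : 0 < a) (hab : a ≤ b) (hb2 : b ≤ 2 * a)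
    {B : Set UnitAddCircle} (hB : MeasurableSet B) :
    |(wrappedGaussian a).real B - (wrappedGaussian b).real B| ≤ 9 * (b / a - 1) := by
  have h1 : 1 ≤ b / a := by rw [le_div_iff₀ ha]; linarith
  exact (abs_measureReal_wrappedGaussian_sub_le ha hab hb2 hB).trans (by nlinarith)

/-- **Regev 2009, Claim 2.2 for the discretised Gaussians** of the tree's LWE problems: for
`0 < a ≤ b ≤ 2a`, `Δ(Ψ̄_a, Ψ̄_b) ≤ 2 (b/a - 1)` (`PMF.tvDist`, i.e. `½ ∑_k |Ψ̄_a(k) - Ψ̄_b(k)|`): the masses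
are the Gaussian measures of the fibres `{x : ⌊qx⌉ ≡ k}`, which partition `ℝ`, so the sum is at most
`∫ |p_a - p_b| ≤ 4(b/a - 1)`. [cite: Regev2009, Claim 2.2] -/
theorem tvDist_discretizedGaussian_le (q : ℕ) [NeZero q] {a b : ℝ} (ha : 0 < a) (hab : a ≤ b)
    (hb2 : b ≤ 2 * a) :
    (discretizedGaussian q a).tvDist (discretizedGaussian q b) ≤ 2 * (b / a - 1) := by
  have hb : 0 < b := lt_of_lt_of_le ha hab
  have hpa := integrable_gaussianPDFReal 0 (widthVar a)
  have hpb := integrable_gaussianPDFReal 0 (widthVar b)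
  set f : ℝ → ℝ := fun x => gaussianPDFReal 0 (widthVar a) x - gaussianPDFReal 0 (widthVar b) x with hf
  have hfi : Integrable f := hpa.sub hpb
  set P : ZMod q → Set ℝ := fun k => discretize q ⁻¹' {k} with hP
  have hPm : ∀ k, MeasurableSet (P k) := fun k => measurable_discretize q (measurableSet_singleton k)
  have hPd : Pairwise (Function.onFun Disjoint P) := fun k k' hkk' =>
    Set.disjoint_iff.2 fun x hx => hkk' (hx.1.symm.trans hx.2)
  have hPU : (⋃ k, P k) = Set.univ := Set.eq_univ_of_forall fun x => Set.mem_iUnion.2 ⟨discretize q x, rfl⟩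
  -- each term is the integral of `f` over a fibre
  have hterm : ∀ k, (discretizedGaussian q a k).toReal - (discretizedGaussian q b k).toReal = ∫ x in P k, f x := by
    intro k
    rw [discretizedGaussian_apply, discretizedGaussian_apply]
    change (gaussianReal 0 (widthVar a)).real (P k) - (gaussianReal 0 (widthVar b)).real (P k) = _
    rw [measureReal_gaussianReal_width ha, measureReal_gaussianReal_width hb,
      ← integral_sub hpa.integrableOn hpb.integrableOn]
  rw [PMF.tvDist, tsum_fintype]
  simp_rw [hterm]
  have hsum : ∑ k, |∫ x in P k, f x| ≤ ∫ x, |f x| :=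
    calc ∑ k, |∫ x in P k, f x| ≤ ∑ k, ∫ x in P k, |f x| :=
          Finset.sum_le_sum fun k _ => abs_integral_le_integral_abs
      _ = ∫ x in ⋃ k, P k, |f x| := (integral_iUnion_fintype hPm hPd fun k => hfi.abs.integrableOn).symm
      _ = ∫ x, |f x| := by rw [hPU, setIntegral_univ]
  have h4 := integral_abs_gaussianPDFReal_width_sub_le ha hab hb2
  have : (2 : ℝ)⁻¹ * ∑ k, |∫ x in P k, f x| ≤ 2⁻¹ * (4 * (b / a - 1)) :=
    mul_le_mul_of_nonneg_left (hsum.trans h4) (by norm_num)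
  linarith

/-- The printed constant: `Δ(Ψ̄_a, Ψ̄_b) ≤ 9 (b/a - 1)`. [cite: Regev2009, Claim 2.2] -/
theorem tvDist_discretizedGaussian_le_nine (q : ℕ) [NeZero q] {a b : ℝ} (ha : 0 < a) (hab : a ≤ b)
    (hb2 : b ≤ 2 * a) :
    (discretizedGaussian q a).tvDist (discretizedGaussian q b) ≤ 9 * (b / a - 1) := by
  have h1 : 1 ≤ b / a := by rw [le_div_iff₀ ha]; linarith
  exact (tvDist_discretizedGaussian_le q ha hab hb2).trans (by nlinarith)

end LWE

end Literature.Computability.Cryptography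

end
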